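import Literature.AnabelianGeometry.EtaleTheta.ThetaCoversTemperedOfHuuOfSection

/-!
# [EtTh] §2 AT THE §1 MODEL: the parameter `g` of `temperedCoverDataOfHuuOfSection` lies in `Π^tp_{C̲}` — the export
# «`ε_± ∈ T.tp T.PiCu`» for the Cor. 2.8 (iii) OUTER junction (Def. 2.3 / 2.5 (i), pp. 38–39 / PDF)

Mochizuki, *The étale theta function and its Frobenioid-theoretic manifestations*, Publ. RIMS **45** (2009) [EtTh], §2:
Def. 2.3 p. 38 («`Π^tp_{C̲} ⊆ Π^tp_C`», the covering `C̲ → C` determined by the `(1, l-tors)±` type), Prop. 2.4 p. 38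
(the list of characteristic subgroups), Def. 2.5 (i) p. 39 (PRIMS PDF pages, printed `+226`)
[cite: MochizukiEtTh2009, Def 2.3 p.38; Def 2.5 (i) p.39].

Cell abc-iut, layer L2, seat abc-iut-L2-d3 (gen 7).  PROOF-ONLY (0 definitions, no new named fact) over this lineage's
class-(b) constructor `CLevelData.temperedCoverDataOfHuuOfSection` (p452017) and `Discharge/Sec2HuuClosureModel.lean`
(p447270).  Requested BY NAME by abc-iut-w6-d049 (STATUS 2026-08-26T18:03:18Z / 18:19:58Z): the Cor. 2.8 (iii) OUTER chain at
the cusped inversion model (`Sec2OuterPC5Reduction` p455742, `Sec1EtaChiEpsMuFixes` p460521) needs, for the cover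
`T := temperedCoverDataOfHuuOfSection … hgX hι` assembled from the chosen `X̲̲ = C.Huu` and a conjugator `g ∈ Π^tp_C ∖ Π^tp_X`
with `C.IotaStable (e.conjX g)`, the membership **`g ∈ T.tp T.PiCu`** («`ε_± ∈ Π^tp_{C̲}`»): the inversion `ι₀` chosen inside
the constructor (Prop. 2.2 (iii)) lies in the coset `ιC(g)·Π_{X̲}`.  The constructor's `∃`-statement exports only (P2)
`Π_{C̲̲} ∩ Π_X = H` and (P6) «`ι₀` normalises `H := cl(ιC(inclX(Π^tp_{X̲̲})))`»; from these, `d := ιC(g)·ι₀⁻¹ ∈ Π_X` NORMALISES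
`H` (both factors do — `ι₀⁻¹` by (P2) and the normality of `Π_X ◁ Π_C`), so the membership follows from ONE tempered input,
stated in Mathlib currency and asserted nowhere:

  `hNX : Subgroup.normalizer ↑C.Huu ≤ M.GtpXu l` — «`N_{Π^tp_X}(Π^tp_{X̲̲}) ⊆ Π^tp_{X̲}`»

(at the χ-models' `Huuχ` a one-line kernel check of the `X̲̲`-owners abc-iut-L2-d1 / abc-iut-L2-t8: conjugation by `(x₀,y₀,z₀)`
moves the `z`-coordinate by `x₀·y` mod `l`), transferred to the profinite side by DENSITY:
* `Subgroup.le_of_denseRange_of_isOpen` — an open subgroup `N` of `P` lies in a closed subgroup `K` as soon as the dense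
  image `ι(G)` meets `N` inside `K` (`Dense.open_subset_closure_inter`);
* `normalizer_closureHuu_inf_PiX_le_closureXu` — **`N_{P_C}(H) ∩ Π_X ≤ Π_{X̲} := cl(ιC(inclX(Π^tp_{X̲})))`** under `hNX`
  (the trace of `ιC(Π^tp_C)` on the open subgroup `N_{P_C}(H) ∩ Π_X` is `ιC(inclX(N_{Π^tp_X}(Π^tp_{X̲̲})))`, by
  `comap_closureHuu` and `mem_range_hatInclX_iff`);
* **`temperedCoverDataOfHuuOfSection_mem_tp_PiCu`** — `g ∈ T.tp T.PiCu` (`ιC g = d·ι₀`, `d ∈ Π_{X̲} = T.PiXu`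
  (`temperedCoverDataOfHuuOfSection_PiXu`), `ι₀ ∈ T.PiCuu`, `T.PiCu = T.PiCuu·Δ̄_Θ-preimage ⊇ T.PiXu`), and the coset form
  `temperedCoverDataOfHuuOfSection_exists_inversion_mem_coset` («`ι₀ ∈ Π_{X̲}·ιC(g)`», with `T.PiCuu = H·⟨ι₀⟩`).
HONEST FRAMING: kernel-checked implication about OUR typed model data under the displayed binder; nothing asserts that a
`MuTwoSetting` exists; [EtTh] is refereed; no side is taken on [IUTchIII] Cor. 3.12; typed ≠ proved.
-/

noncomputable section

namespace Literature.AnabelianGeometry.EtaleTheta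

open Literature.AnabelianGeometry.SemiGraphs ThetaCovers
open _root_.Topology

/-- **Density transfer**: for a homomorphism `ι : G → P` with dense image, an OPEN subgroup `N ≤ P` lies in a CLOSED
subgroup `K ≤ P` as soon as `ι(x) ∈ N ⇒ ι(x) ∈ K` for all `x : G` (`N ⊆ cl(N ∩ ι(G))`, `Dense.open_subset_closure_inter`).
The device behind «tempered statements pass to the profinite completion» ([EtTh] Prop. 2.4 p.38: the subgroups of
`Π^tp_C` and their closures in `Π_C`). [cite: MochizukiEtTh2009, Prop 2.4 p.38] -/
theorem Subgroup.le_of_denseRange_of_isOpen {G P : Type*} [Group G] [Group P] [TopologicalSpace P]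
    (ι : G →* P) (hι : DenseRange ι) {N K : Subgroup P} (hN : IsOpen (N : Set P)) (hK : IsClosed (K : Set P))
    (h : ∀ x : G, ι x ∈ N → ι x ∈ K) : N ≤ K := by
  intro n hn
  have h1 : (N : Set P) ⊆ closure ((N : Set P) ∩ Set.range ι) := hι.open_subset_closure_inter hN
  have h2 : (N : Set P) ∩ Set.range ι ⊆ (K : Set P) := by
    rintro _ ⟨hxN, x, rfl⟩
    exact h x hxN
  exact hK.closure_subset_iff.2 h2 (h1 hn)

namespace MuTwoSetting.CLevelData

variable {p : ℕ} [Fact p.Prime] {M : MuTwoSetting p}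
variable {PC : Type} [Group PC] [TopologicalSpace PC] [IsTopologicalGroup PC] [T2Space PC]

/-- **`N_{P_C}(H) ∩ Π_X ≤ Π_{X̲}`** for `H := cl(ιC(inclX(Π^tp_{X̲̲})))`, `Π_{X̲} := cl(ιC(inclX(Π^tp_{X̲})))`, GIVEN the tempered
clause `N_{Π^tp_X}(Π^tp_{X̲̲}) ⊆ Π^tp_{X̲}` (`hNX`): the open subgroup `N_{P_C}(H) ∩ Π_X` meets the dense `ιC(Π^tp_C)` in
`ιC(inclX(N_{Π^tp_X}(Π^tp_{X̲̲})))` (`ιC⁻¹(H) = inclX(Π^tp_{X̲̲})`, `ιC⁻¹(Π_X) = inclX(Π^tp_X)`), which lies in the closed `Π_{X̲}`.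
[cite: MochizukiEtTh2009, Def 2.5 (i) p.39; Prop 2.4 p.38] -/
theorem normalizer_closureHuu_inf_PiX_le_closureXu (e : M.CLevelData) (ιC : M.GtpC →ₜ* PC)
    (hιC : IsProfiniteCompletion ιC) {E : M.toThetaSetting.EtaleThetaData} {l : ℕ} (C : E.DoubleUnderline l)
    (hNX : Subgroup.normalizer (C.Huu : Set M.PiTemp) ≤ M.GtpXu l) :
    Subgroup.normalizer ((((C.Huu.map M.inclX).map ιC.toMonoidHom).topologicalClosure : Subgroup PC) : Set PC) ⊓
      (e.piCDataOf ιC hιC).PiX ≤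
      (((M.GtpXu l).map M.inclX).map ιC.toMonoidHom).topologicalClosure := by
  set I := e.piCDataOf ιC hιC with hI
  set H := ((C.Huu.map M.inclX).map ιC.toMonoidHom).topologicalClosure with hH
  set Xu := (((M.GtpXu l).map M.inclX).map ιC.toMonoidHom).topologicalClosure with hXu
  have hopen : IsOpen ((Subgroup.normalizer (H : Set PC) ⊓ I.PiX : Subgroup PC) : Set PC) := by
    rw [Subgroup.coe_inf]
    exact (Subgroup.isOpen_mono Subgroup.le_normalizer (e.isOpen_closureHuu ιC hιC C)).inter I.isOpen_PiX
  refine Subgroup.le_of_denseRange_of_isOpen ιC.toMonoidHom hιC.denseRange hopen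
    (Subgroup.isClosed_topologicalClosure _) fun x hx => ?_
  obtain ⟨hxN, hxX⟩ := Subgroup.mem_inf.1 hx
  -- `ιC x ∈ Π_X` ⇒ `x = inclX x'`
  obtain ⟨x', rfl⟩ := (mem_range_hatInclX_iff ιC hιC I.incl (e.piCDataOf_incl_toHat ιC hιC) x).1 hxX
  -- `h ∈ Π^tp_{X̲̲} ↔ ιC(inclX h) ∈ H`
  have hmem : ∀ h : M.PiTemp, h ∈ C.Huu ↔ ιC (M.inclX h) ∈ H := fun h => by
    rw [← Subgroup.mem_map_iff_mem M.injective_inclX, ← e.comap_closureHuu ιC hιC C, Subgroup.mem_comap]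
    rfl
  -- `x'` normalises `Π^tp_{X̲̲}`
  have hx' : x' ∈ Subgroup.normalizer (C.Huu : Set M.PiTemp) := by
    rw [Subgroup.mem_normalizer_iff]
    intro h
    rw [hmem h, hmem (x' * h * x'⁻¹), map_mul, map_mul, map_inv, map_mul, map_mul, map_inv]
    exact (Subgroup.mem_normalizer_iff.1 hxN) _
  exact Subgroup.le_topologicalClosure _ ⟨M.inclX x', ⟨x', hNX hx', rfl⟩, rfl⟩

section MemPiCu

variable (e : M.CLevelData) (ιC : M.GtpC →ₜ* PC) (hιC : IsProfiniteCompletion ιC)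
  (hinj : Function.Injective ιC) (op : M.toThetaSetting.OncePuncturedData) {l : ℕ} (hodd : Odd l)
  (s : ↥M.GK →* M.PiTemp) (hsa : ∀ σ, M.aug (s σ) = (σ : GQp p)) (hsZ : ∀ σ, M.toZ (s σ) = 1)
  (hιell : ∀ c ∈ (e.piCDataOf ιC hιC).augGK.ker, c ∉ (e.piCDataOf ιC hιC).PiX →
    ∀ d ∈ (e.piCDataOf ιC hιC).PiX ⊓ (e.piCDataOf ιC hιC).augGK.ker,
      c * d * c⁻¹ * d ∈ (e.piCDataOf ιC hιC).barTheta l)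
  (hN : ((M.GtpXu l).map M.inclX).Normal) (hY : (M.GtpY.map M.inclX).Normal)
  {E : M.toThetaSetting.EtaleThetaData} (C : E.DoubleUnderline l) (hK : M.barKerTp l ≤ C.Huu)
  (hsH : ∀ σ, s σ ∈ C.Huu) {g : M.GtpC} (hgX : g ∉ M.inclX.range) (hι : C.IotaStable (e.conjX g))

/-- **The chosen inversion lies in the coset `Π_{X̲}·ιC(g)`** (GIVEN `hNX`): for the `ι₀` with `T.PiCuu = H·⟨ι₀⟩` one has
`ι₀ ∈ Δ_C ∖ Π_X`, `ι₀² ∈ Ker(Δ_X ↠ Δ̄_X)`, `ι₀` normalises `H`, AND `ιC(g)·ι₀⁻¹ ∈ Π_{X̲} := cl(ιC(inclX(Π^tp_{X̲})))` —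
the clause the constructor's proof had internally (`c⁻¹·ι₀ ∈ Π_{X̲}`) and did not export, recovered from (P2) + (P6).
[cite: MochizukiEtTh2009, Def 2.3 p.38; Def 2.5 (i) p.39] -/
theorem temperedCoverDataOfHuuOfSection_exists_inversion_mem_coset
    (hNX : Subgroup.normalizer (C.Huu : Set M.PiTemp) ≤ M.GtpXu l) :
    ∃ ι₀ : PC, ι₀ ∈ (e.piCDataOf ιC hιC).augGK.ker ∧ ι₀ ∉ (e.piCDataOf ιC hιC).PiX ∧
      ι₀ * ι₀ ∈ (e.piCDataOf ιC hιC).barKer l ∧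
      (∀ h ∈ ((C.Huu.map M.inclX).map ιC.toMonoidHom).topologicalClosure,
        ι₀ * h * ι₀⁻¹ ∈ ((C.Huu.map M.inclX).map ιC.toMonoidHom).topologicalClosure) ∧
      (e.temperedCoverDataOfHuuOfSection ιC hιC hinj op hodd s hsa hsZ hιell hN hY C hK hsH hgX hι).PiCuu =
        ((C.Huu.map M.inclX).map ιC.toMonoidHom).topologicalClosure ⊔ Subgroup.zpowers ι₀ ∧
      ιC g * ι₀⁻¹ ∈ (((M.GtpXu l).map M.inclX).map ιC.toMonoidHom).topologicalClosure := by
  set T := e.temperedCoverDataOfHuuOfSection ιC hιC hinj op hodd s hsa hsZ hιell hN hY C hK hsH hgX hι with hT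
  set I := e.piCDataOf ιC hιC with hI
  set H := ((C.Huu.map M.inclX).map ιC.toMonoidHom).topologicalClosure with hH
  set Xu := (((M.GtpXu l).map M.inclX).map ιC.toMonoidHom).topologicalClosure with hXu
  obtain ⟨ι₀, hι₀Δ, hι₀X, h2, hnorm, hPiCuu⟩ :=
    e.temperedCoverDataOfHuuOfSection_PiCuu ιC hιC hinj op hodd s hsa hsZ hιell hN hY C hK hsH hgX hι
  refine ⟨ι₀, hι₀Δ, hι₀X, h2, hnorm, hPiCuu, ?_⟩
  have hHX : H ≤ I.PiX := e.closureHuu_le_PiX ιC hιC C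
  -- (P2): `(H·⟨ι₀⟩) ∩ Π_X = H`
  have hP2 : (H ⊔ Subgroup.zpowers ι₀) ⊓ I.PiX = H := by
    have h := e.temperedCoverDataOfHuuOfSection_PiXuu ιC hιC hinj op hodd s hsa hsZ hιell hN hY C hK hsH hgX hι
    rw [TemperedCoverData.PiXuu, hPiCuu] at h
    exact h
  -- `ιC g ∉ Π_X`, so `d := ιC g · ι₀⁻¹ ∈ Π_X` (index `2`)
  have hgX' : ιC g ∉ I.PiX := fun h =>
    hgX ((mem_range_hatInclX_iff ιC hιC I.incl (e.piCDataOf_incl_toHat ιC hιC) g).1 h)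
  have hdX : ιC g * ι₀⁻¹ ∈ I.PiX :=
    (Subgroup.mul_mem_iff_of_index_two I.index_range).2 (iff_of_false hgX' fun h => hι₀X (inv_mem_iff.1 h))
  -- `ιC g` normalises `H` (`IotaStable`)
  have hgN : ιC g ∈ Subgroup.normalizer (H : Set PC) := by
    rw [Subgroup.mem_normalizer_iff]
    intro n
    refine ⟨fun hn => e.conj_mem_closureHuu ιC C hι hn, fun hn => ?_⟩
    have h' := e.conj_inv_mem_closureHuu ιC C hι hn
    have key : (ιC g)⁻¹ * (ιC g * n * (ιC g)⁻¹) * ιC g = n := by group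
    rwa [key] at h'
  -- `ι₀` normalises `H` ((P6) for one direction, (P2) + normality of `Π_X` for the other)
  have hι₀N : ι₀ ∈ Subgroup.normalizer (H : Set PC) := by
    rw [Subgroup.mem_normalizer_iff]
    intro n
    refine ⟨fun hn => hnorm n hn, fun hn => ?_⟩
    have hmem1 : n ∈ H ⊔ Subgroup.zpowers ι₀ := by
      have key : ι₀⁻¹ * (ι₀ * n * ι₀⁻¹) * ι₀ = n := by group
      rw [← key]
      exact Subgroup.mul_mem _ (Subgroup.mul_mem _
        (Subgroup.mem_sup_right (Subgroup.inv_mem _ (Subgroup.mem_zpowers ι₀))) (Subgroup.mem_sup_left hn))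
        (Subgroup.mem_sup_right (Subgroup.mem_zpowers ι₀))
    have hmem2 : n ∈ I.PiX := by
      have hc := I.range_normal.conj_mem _ (hHX hn) ι₀⁻¹
      have key : ι₀⁻¹ * (ι₀ * n * ι₀⁻¹) * ι₀⁻¹⁻¹ = n := by group
      rwa [key] at hc
    have h : n ∈ (H ⊔ Subgroup.zpowers ι₀) ⊓ I.PiX := Subgroup.mem_inf.2 ⟨hmem1, hmem2⟩
    rwa [hP2] at h
  -- density transfer
  exact e.normalizer_closureHuu_inf_PiX_le_closureXu ιC hιC C hNX
    (Subgroup.mem_inf.2 ⟨Subgroup.mul_mem _ hgN (Subgroup.inv_mem _ hι₀N), hdX⟩)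

/-- **`g ∈ Π^tp_{C̲}` of the assembled cover** («`ε_± ∈ T.tp T.PiCu`», abc-iut-w6-d049's junction clause for Cor. 2.8 (iii)
OUTER at the cusped inversion model), GIVEN `hNX : N_{Π^tp_X}(Π^tp_{X̲̲}) ⊆ Π^tp_{X̲}`: `ιC(g) = d·ι₀` with
`d ∈ Π_{X̲} = T.PiXu ≤ T.PiCu` and `ι₀ ∈ T.PiCuu ≤ T.PiCu`. [cite: MochizukiEtTh2009, Def 2.3 p.38; Def 2.5 (i) p.39] -/
theorem temperedCoverDataOfHuuOfSection_mem_tp_PiCu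
    (hNX : Subgroup.normalizer (C.Huu : Set M.PiTemp) ≤ M.GtpXu l) :
    g ∈ (e.temperedCoverDataOfHuuOfSection ιC hιC hinj op hodd s hsa hsZ hιell hN hY C hK hsH hgX hι).tp
      (e.temperedCoverDataOfHuuOfSection ιC hιC hinj op hodd s hsa hsZ hιell hN hY C hK hsH hgX hι).PiCu := by
  set T := e.temperedCoverDataOfHuuOfSection ιC hιC hinj op hodd s hsa hsZ hιell hN hY C hK hsH hgX hι with hT
  obtain ⟨ι₀, -, -, -, -, hPiCuu, hd⟩ :=
    e.temperedCoverDataOfHuuOfSection_exists_inversion_mem_coset ιC hιC hinj op hodd s hsa hsZ hιell hN hY C hK hsH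
      hgX hι hNX
  have hXuCu : (((M.GtpXu l).map M.inclX).map ιC.toMonoidHom).topologicalClosure ≤ T.PiCu := by
    rw [← e.temperedCoverDataOfHuuOfSection_PiXu ιC hιC hinj op hodd s hsa hsZ hιell hN hY C hK hsH hgX hι,
      TemperedCoverData.PiXu, TemperedCoverData.PiCu, TemperedCoverData.PiXuu]
    exact sup_le_sup_right inf_le_left _
  have hι₀Cu : ι₀ ∈ T.PiCu := by
    rw [TemperedCoverData.PiCu]
    refine Subgroup.mem_sup_left ?_
    rw [hPiCuu]
    exact Subgroup.mem_sup_right (Subgroup.mem_zpowers ι₀)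
  change ιC g ∈ T.PiCu
  rw [← inv_mul_cancel_right (ιC g) ι₀]
  exact Subgroup.mul_mem _ (hXuCu hd) hι₀Cu

end MemPiCu

end MuTwoSetting.CLevelData

end Literature.AnabelianGeometry.EtaleTheta

end
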